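import Summits.CriticalPhenomena.PercolationContinuityZ3.Theorems.Transplant.SkelSeedSlabIn
import HarnessLib

/-!
# L5.5b v2, part 2 — interior slab seeds avoid the Step-V shell `S = (shell) ∪ (far faces)` (`slabSeedIn_notMem_wireSet`; companion of
# `SkelSeedSlabIn`, see its module docstring for the bookkeeping reason)

builds on p205010 (kernel theorem, internal audit signed; external expert review pending) — nothing in this file uses p205010.
Lane `prim-bschramm`, seat `prim-bschramm-p1` (gen 7); helper file (`--supports stmt-CriticalPhenomena-4575 --as helper`); namespace
`Transplant.SkelI`, `[DecidableEq V]` binder.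
[cite: KozmaNitzan2024, §4 Lemma 10, p. 21 (U(P), "Q ⊆ S", "P_{K_ξ}(F_P) = P_G(F_P)"), pp. 21–22 (Step V)]
-/

noncomputable section

open scoped Classical

namespace Summit.CriticalPhenomena.PercolationContinuityZ3.Theorems

namespace Transplant

namespace SkelI

open Literature.Probability.Percolation Literature.Probability.LatticeModels SimpleGraph KNLevels
open Literature.Barriers.CriticalPhenomena (graphBall graphBall_finite mem_graphBall_self graphBall_mono)
open BoxProdZ2 (ballFin mem_ballFin card_ballFin_le)
open Skel (winGraph winGraph_adj winLevel mem_winLevel_iff winLevel_monotone winLevel_subset_graphBall winLData winLData_X inNbr KitGeom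
  cylBallFin mem_cylBallFin pathIn_cylBall' cylBall_subset_cyl)

variable {V : Type} [DecidableEq V] {G : SimpleGraph V} [G.LocallyFinite] (Φ : PlanarSkeletonConc G)

/-! ## §3 Interior slabs avoid the shell and the far boundary layer -/

/-- **Slab seeds avoid the pairs of the Step-V shell `S = (shell) ∪ (far faces)`**: if `T ⊆ B⟨j⟩` consists of SHELL vertices
(`φ ∈ Icc (Lo + 2ℓs + 2) (Hi − 2ℓs − 2)`) and FAR BOUNDARY-LAYER vertices (`φ ∉ Icc (Lo+1) (Hi−1)`, outside `B_G(w₀, R − r₀)`), then no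
seed edge of the interior slab geometry is a pair of `T`: the contact edge has the contact off `T`; every other near seed edge has an
endpoint in the interior slab `{y₂} ∪ cylBall` or is `y — y₁` with `y` near; the far seed is the contact edge.
[cite: KozmaNitzan2024, §4 p. 21 ("P_{K_ξ}(F_P) = P_G(F_P)")] -/
theorem slabSeedIn_notMem_wireSet {w₀ : V} {R : ℕ} {lo hi : Site 2} {j ℓs R' r₀ : ℕ} {Unear : V → Finset V}
    (hℓs : 1 ≤ ℓs) (hwide : ∀ i, (lo - (j : Site 2)) i + 2 * (ℓs + 1) ≤ (hi + (j : Site 2)) i)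
    (hUsh : ∀ x ∈ outerBoundary (winGraph G w₀ R) (winLevel Φ w₀ R lo hi j), ∀ u ∈ Unear x,
      Φ.φ u ∈ Finset.Icc (lo - (j : Site 2) + ((2 * ℓs + 2 : ℕ) : Site 2)) (hi + (j : Site 2) - ((2 * ℓs + 2 : ℕ) : Site 2)))
    {x : V} (hx : x ∈ outerBoundary (winGraph G w₀ R) (winLevel Φ w₀ R lo hi j)) {T : Set V}
    (hT : ∀ v ∈ T, Φ.φ v ∈ Finset.Icc (lo - (j : Site 2)) (hi + (j : Site 2)) ∧
      (Φ.φ v ∈ Finset.Icc (lo - (j : Site 2) + ((2 * ℓs + 2 : ℕ) : Site 2)) (hi + (j : Site 2) - ((2 * ℓs + 2 : ℕ) : Site 2)) ∨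
        (Φ.φ v ∉ Finset.Icc (lo - (j : Site 2) + 1) (hi + (j : Site 2) - 1) ∧ v ∉ graphBall G w₀ (R - r₀))))
    {e : Sym2 V} (he : e ∈ kitSeed G (slabGeomIn Φ w₀ R lo hi j ℓs R' r₀ Unear) x) : e ∉ wireSet T := by
  -- normal form for the planar arithmetic: everything distributed to `lo i`, `hi i`, `(j : ℤ)`, `φ _ i`
  have hw2 : ∀ i, (lo - (j : Site 2)) i + 2 ≤ (hi + (j : Site 2)) i := fun i => by have := hwide i; omega
  have hx' : x ∈ outerBoundary (winGraph G w₀ R) (Φ.Win w₀ (Finset.Icc (lo - (j : Site 2)) (hi + (j : Site 2))) R) := hx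
  obtain ⟨hadj, hyR, hyP⟩ := inNbr_spec Φ hx'
  set y := inNbr Φ w₀ R (Finset.Icc (lo - (j : Site 2)) (hi + (j : Site 2))) x with hydef
  obtain ⟨i₀, hface⟩ := exists_coord_eq_of_contact Φ hx'
  -- scalar facts at the exit coordinate `i₀`
  have hwD : lo i₀ - (j : ℤ) + 2 * (ℓs + 1) ≤ hi i₀ + (j : ℤ) := by
    have h := hwide i₀; simp only [Pi.add_apply, Pi.sub_apply, Pi.natCast_apply] at h; exact h
  have hfaceD : Φ.φ y i₀ = lo i₀ - (j : ℤ) ∨ Φ.φ y i₀ = hi i₀ + (j : ℤ) := by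
    rcases hface with h | h <;> [left; right] <;> rw [h] <;> simp only [Pi.add_apply, Pi.sub_apply, Pi.natCast_apply]
  -- membership tests, all at the coordinate `i₀`
  -- (a) shell membership gives `lo i₀ - j + (2ℓs+2) ≤ φ v i₀ ≤ hi i₀ + j - (2ℓs+2)`
  have hshell : ∀ v : V, Φ.φ v ∈ Finset.Icc (lo - (j : Site 2) + ((2 * ℓs + 2 : ℕ) : Site 2)) (hi + (j : Site 2) - ((2 * ℓs + 2 : ℕ) : Site 2)) →
      lo i₀ - (j : ℤ) + (2 * ℓs + 2) ≤ Φ.φ v i₀ ∧ Φ.φ v i₀ ≤ hi i₀ + (j : ℤ) - (2 * ℓs + 2) := by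
    intro v hv
    rw [Finset.mem_Icc] at hv
    have h1 : (lo - (j : Site 2) + ((2 * ℓs + 2 : ℕ) : Site 2)) i₀ ≤ Φ.φ v i₀ := hv.1 i₀
    have h2 : Φ.φ v i₀ ≤ (hi + (j : Site 2) - ((2 * ℓs + 2 : ℕ) : Site 2)) i₀ := hv.2 i₀
    simp only [Pi.add_apply, Pi.sub_apply, Pi.natCast_apply] at h1 h2
    push_cast at h1 h2
    exact ⟨h1, h2⟩
  -- (b) interior membership: `lo i + 1 - j ≤ φ v i ≤ hi i + j - 1` at every `i`
  have hinter : ∀ v : V, Φ.φ v ∈ Finset.Icc (lo - (j : Site 2) + 1) (hi + (j : Site 2) - 1) ↔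
      ∀ i, lo i - (j : ℤ) + 1 ≤ Φ.φ v i ∧ Φ.φ v i ≤ hi i + (j : ℤ) - 1 := by
    intro v
    rw [Finset.mem_Icc]
    constructor
    · rintro ⟨h1, h2⟩ i
      have a : (lo - (j : Site 2) + 1) i ≤ Φ.φ v i := h1 i
      have b : Φ.φ v i ≤ (hi + (j : Site 2) - 1) i := h2 i
      simp only [Pi.add_apply, Pi.sub_apply, Pi.natCast_apply, Pi.one_apply] at a b
      exact ⟨a, b⟩
    · intro h
      constructor <;> intro i <;> have hi' := h i <;> simp only [Pi.add_apply, Pi.sub_apply, Pi.natCast_apply, Pi.one_apply] <;> omega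
  -- the cylinder about the slab centre: exit-depth in `[1, 2ℓs+1]`, all coordinates interior
  have hcylD : ∀ v ∈ Φ.cylBall (slabCtr Φ (lo - (j : Site 2)) (hi + (j : Site 2)) (ℓs + 1) y) ℓs R',
      (∀ i, lo i - (j : ℤ) + 1 ≤ Φ.φ v i ∧ Φ.φ v i ≤ hi i + (j : ℤ) - 1) ∧
      (Φ.φ v i₀ ≤ lo i₀ - (j : ℤ) + (2 * ℓs + 1) ∨ hi i₀ + (j : ℤ) - (2 * ℓs + 1) ≤ Φ.φ v i₀) := by
    intro v hv
    have hcyl := cylBall_subset_cyl Φ _ ℓs R' hv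
    rw [PlanarSkeleton.mem_cyl, (slabCtr_spec Φ hwide hyP).2] at hcyl
    have hin := add_mem_Icc_interior_of_mem_box hwide (Φ.φ y) hcyl
    rw [add_sub_cancel] at hin
    refine ⟨(hinter v).1 hin, ?_⟩
    rw [mem_box] at hcyl
    have hc := hcyl i₀
    simp only [Pi.sub_apply, slabPt, max_def, min_def, Pi.add_apply, Pi.natCast_apply, Nat.cast_add, Nat.cast_one] at hc
    rcases hfaceD with h | h <;> rw [h] at hc <;> split_ifs at hc <;> omega
  -- the path vertices `y₁`, `y₂`: within depth 2 of the face at `i₀`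
  have hy12 : |Φ.φ (inward Φ (lo - (j : Site 2)) (hi + (j : Site 2)) 0 y) i₀ - Φ.φ y i₀| ≤ 2 ∧
      |Φ.φ (inward Φ (lo - (j : Site 2)) (hi + (j : Site 2)) 1 (inward Φ (lo - (j : Site 2)) (hi + (j : Site 2)) 0 y)) i₀ - Φ.φ y i₀| ≤ 2 := by
    obtain ⟨-, h1i, h1k⟩ := inward_spec Φ 0 (hw2 0) hyP
    have hyb := hyP
    rw [Finset.mem_Icc] at hyb
    have hl : (lo - (j : Site 2)) i₀ ≤ Φ.φ y i₀ := hyb.1 i₀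
    have hh : Φ.φ y i₀ ≤ (hi + (j : Site 2)) i₀ := hyb.2 i₀
    have hw := hw2 i₀
    constructor
    · by_cases hi0 : i₀ = 0
      · subst hi0; rw [h1i]; simp only [slabPt, max_def, min_def, Nat.cast_one]; rw [abs_le]; split_ifs <;> constructor <;> omega
      · rw [h1k i₀ hi0, sub_self, abs_zero]; norm_num
    · rw [φ_inward_inward Φ hw2 hyP]; simp only [slabPt, max_def, min_def, Nat.cast_one]; rw [abs_le]; split_ifs <;> constructor <;> omega
  -- `y₂` is interior and below the shell
  have hy2D : (∀ i, lo i - (j : ℤ) + 1 ≤ Φ.φ (inward Φ (lo - (j : Site 2)) (hi + (j : Site 2)) 1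
      (inward Φ (lo - (j : Site 2)) (hi + (j : Site 2)) 0 y)) i ∧ Φ.φ (inward Φ (lo - (j : Site 2)) (hi + (j : Site 2)) 1
      (inward Φ (lo - (j : Site 2)) (hi + (j : Site 2)) 0 y)) i ≤ hi i + (j : ℤ) - 1) := by
    intro i
    rw [φ_inward_inward Φ hw2 hyP]
    have hyb := hyP
    rw [Finset.mem_Icc] at hyb
    have hl : (lo - (j : Site 2)) i ≤ Φ.φ y i := hyb.1 i
    have hh : Φ.φ y i ≤ (hi + (j : Site 2)) i := hyb.2 i
    have hw := hw2 i
    simp only [Pi.add_apply, Pi.sub_apply, Pi.natCast_apply] at hl hh hw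
    simp only [slabPt, max_def, min_def, Nat.cast_one, Pi.add_apply, Pi.sub_apply, Pi.natCast_apply]
    split_ifs <;> constructor <;> omega
  -- scalar face facts for `y`
  have hyD : lo i₀ - (j : ℤ) ≤ Φ.φ y i₀ ∧ Φ.φ y i₀ ≤ hi i₀ + (j : ℤ) := by
    have hyb := hyP
    rw [Finset.mem_Icc] at hyb
    have hl : (lo - (j : Site 2)) i₀ ≤ Φ.φ y i₀ := hyb.1 i₀
    have hh : Φ.φ y i₀ ≤ (hi + (j : Site 2)) i₀ := hyb.2 i₀
    simp only [Pi.add_apply, Pi.sub_apply, Pi.natCast_apply] at hl hh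
    exact ⟨hl, hh⟩
  -- WHO IS OUTSIDE `T`
  have hxT : x ∉ T := fun hxT => ((mem_outerBoundary_win_iff Φ).1 hx').2.1 (hT x hxT).1
  have hyT : y ∈ graphBall G w₀ (R - r₀) → y ∉ T := fun hnear h => by
    rcases (hT y h).2 with h' | ⟨-, h'⟩
    · have := hshell y h'; rcases hfaceD with hf | hf <;> omega
    · exact h' hnear
  have hcylT : ∀ v ∈ Φ.cylBall (slabCtr Φ (lo - (j : Site 2)) (hi + (j : Site 2)) (ℓs + 1) y) ℓs R', v ∉ T := by
    intro v hv hvT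
    obtain ⟨hin, hdep⟩ := hcylD v hv
    rcases (hT v hvT).2 with h' | ⟨h', -⟩
    · have := hshell v h'; rcases hdep with hd | hd <;> omega
    · exact h' ((hinter v).2 hin)
  have hy2T : inward Φ (lo - (j : Site 2)) (hi + (j : Site 2)) 1 (inward Φ (lo - (j : Site 2)) (hi + (j : Site 2)) 0 y) ∉ T := by
    intro hvT
    rcases (hT _ hvT).2 with h' | ⟨h', -⟩
    · have := hshell _ h'
      have h2 := hy12.2; rw [abs_le] at h2
      rcases hfaceD with hf | hf <;> omega
    · exact h' ((hinter _).2 hy2D)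
  intro hw
  -- case analysis of the seed edge
  rcases mem_kitSeed_cases _ he with rfl | hE | ⟨v, hv, u, hu, hvu, rfl⟩
  · exact hxT (hw.1 x (Sym2.mem_mk_left _ _))
  · -- an edge inside the region
    simp only [slabGeomIn] at hE
    split_ifs at hE with hnear
    · rw [mem_edgesIn_iff] at hE
      induction e using Sym2.ind with
      | h a b =>
        have ha := hE.2 a (Sym2.mem_mk_left a b); have hb := hE.2 b (Sym2.mem_mk_right a b)
        have haT := hw.1 a (Sym2.mem_mk_left a b); have hbT := hw.1 b (Sym2.mem_mk_right a b)
        have hab : G.Adj a b := (SimpleGraph.mem_edgeSet (G := G)).1 hE.1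
        have hmemT : ∀ c ∈ ({y, inward Φ (lo - (j : Site 2)) (hi + (j : Site 2)) 0 y,
            inward Φ (lo - (j : Site 2)) (hi + (j : Site 2)) 1 (inward Φ (lo - (j : Site 2)) (hi + (j : Site 2)) 0 y)} ∪
            cylBallFin Φ (slabCtr Φ (lo - (j : Site 2)) (hi + (j : Site 2)) (ℓs + 1) y) ℓs R' : Finset V), c ∈ T →
            c = inward Φ (lo - (j : Site 2)) (hi + (j : Site 2)) 0 y := by
          intro c hc hcT
          rw [Finset.mem_union] at hc
          rcases hc with hc | hc
          · simp only [Finset.mem_insert, Finset.mem_singleton] at hc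
            rcases hc with rfl | rfl | rfl
            · exact absurd hcT (hyT hnear)
            · rfl
            · exact absurd hcT hy2T
          · exact absurd hcT (hcylT c ((mem_cylBallFin Φ).1 hc))
        exact hab.ne ((hmemT a ha haT).trans (hmemT b hb hbT).symm)
    · -- far: the region is `{y}`, no edge inside
      rw [mem_edgesIn_iff] at hE
      induction e using Sym2.ind with
      | h a b =>
        have ha := hE.2 a (Sym2.mem_mk_left a b); have hb := hE.2 b (Sym2.mem_mk_right a b)
        rw [Finset.mem_singleton] at ha hb
        exact ((SimpleGraph.mem_edgeSet (G := G)).1 hE.1).ne (ha.trans hb.symm)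
  · -- a rung `v — u`
    simp only [slabGeomIn] at hv hu
    split_ifs at hv hu with hnear
    · have huS := hshell u (hUsh x hx u hu)
      have hvT : v ∈ T := hw.1 v (Sym2.mem_mk_left _ _)
      rw [Finset.mem_union] at hv
      rcases hv with hv | hv
      · -- `v ∈ {y, y₁, y₂}`: within depth 2 of the face; `u` at depth ≥ 2ℓs+2 ≥ 4: not adjacent
        have hlip := Φ.lip hvu i₀
        rw [abs_le] at hlip
        have hvi : |Φ.φ v i₀ - Φ.φ y i₀| ≤ 2 := by
          simp only [Finset.mem_insert, Finset.mem_singleton] at hv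
          rcases hv with rfl | rfl | rfl
          · rw [sub_self, abs_zero]; norm_num
          · exact hy12.1
          · exact hy12.2
        rw [abs_le] at hvi
        rcases hfaceD with hf | hf <;> omega
      · exact hcylT v ((mem_cylBallFin Φ).1 hv) hvT
    · -- far: `S x = U x = {y}`, a rung would be a loop
      rw [Finset.mem_singleton] at hv hu
      exact hvu.ne (hv.trans hu.symm)

end SkelI

end Transplant

end Summit.CriticalPhenomena.PercolationContinuityZ3.Theorems

end
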